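import Summits.Parity.GeneralizedHardyLittlewood.Theorems.GoldbachHeathBrownDispersionHeathBrownMorozUniformOfClassLemmas
import Literature.NumberTheory.Sieve.CubicFormClassWeightIdentity
import HarnessLib

/-!
# Crux idea `sibling-class-differencing` (stmt-Parity-19915, ideator #2, g2) — first lemmas

Lever: compare an admissible class `(a, b) mod d` of Heath-Brown's box NOT with `κ_d·ℬ` (campaign /
`unit-split-positivity`) and NOT with `(w(d)/d²)·parent` (`parent-differencing`), but with a SIBLING
admissible class `(a', b') mod d` of the SAME modulus.  Every main term of Heath-Brown's decomposition is
class-blind among admissible siblings — the class Type-I main term of the tree's `class_typeI_A` is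
`[(d, N R) = 1]·(6η²X²/π²)(ζ(2)/ζ_d(2))d⁻²ρ₂(R)/N R`, with no `a, b` in it, for EVERY ideal `R` (coprime to
`d` or not), and `classKappa σ₀ X η d` depends on `d` only — so the leading-part comparison (Lemma 3.9 for
classes, hypothesis `h39` of `heathBrownMorozUniform_of_classLemmas`) degenerates, for sibling
DIFFERENCES, to a sum of class Type-I ERRORS: no `Σ₁^{(d)}(L)` asymptotics, no Euler-factor lemma, no
Perron.  The density `w(d)/d²` is recovered at the level of PRIME COUNTS by counting classes
(`classWeight_mul_card_coprimeClasses`: `w(d)·ν*_d = d²`, in tree) and the `d = 1` theorem, because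
non-admissible classes contain no prime value once `X ≥ d`.

Contents: the new analytic stub `SiblingLeading` (= `h39` for sibling differences), the frame statements
`SiblingBand`, `ParentBand`, `SiblingAverageTransfer`, `ClassPartition`, and the averaging inequality
`abs_sub_avg_le` (proved) that drives the transfer.
-/

noncomputable section

open Polynomial NumberField Finset Filter Topology Asymptotics

namespace Summit.Parity.GeneralizedHardyLittlewood.Cruxes.HeathBrownMorozUniform.SiblingDifferencing

open Literature.NumberTheory.Sieve.CubicSieve Literature.NumberTheory.Sieve.CubicPrimes
open Literature.NumberTheory.LFunctions.CubeRootTwoField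
open Summit.Parity.GeneralizedHardyLittlewood.Theorems.GoldbachHeathBrownDispersionHeathBrownMorozUniform

/-! ### (L) The one new analytic stub: Lemma 3.9 for sibling DIFFERENCES (`h39cc`) -/

/-- **`h39cc` — the class leading parts, differenced between admissible siblings.**  For two reduced
admissible classes `(a,b)`, `(a',b')` modulo the same `d`, the `e`-bilinear forms of Heath-Brown's
decomposition differ by `≪ M⁻¹η^{5/2}X²(log X)^c` (the tolerance of `h39`).  Proof route: steps (10.1)–(10.2)
of [HeathBrownActa2001, §10] for each class via `classCountA_le_countA` and the PARENT bounds
(`abs_Ue_sub_U1_le`, `E1_pairs_le_*`), the exchange `bilin_sum_divisors_eq`, then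
`|∑_{R,J} α_Rβ_J(#𝒜^{cl}_{RJ} − #𝒜^{cl'}_{RJ})| ≤ AB·∑_D (|#𝒜^{cl}_D − M_D| + |#𝒜^{cl'}_D − M_D|)` with the
SAME `M_D` (class-blind main term of `class_typeI_A`), summed by the class analogue of
`exists_typeI_squarefree_sum_le` up to `N(D) ≤ 24X^{2−τ/2}`, absorbed by `eventually_typeI_absorb`.
Steps (10.3)–(10.5) (`Σ₁(L)`, `Σ'`, `Σ₃`, `σ₀`) never occur: there is no main term to evaluate. -/
def SiblingLeading : Prop :=
  ∀ d a b a' b' : ℕ, 0 < d → a < d → b < d → a' < d → b' < d →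
    Nat.Coprime (a ^ 3 + 2 * b ^ 3) d → Nat.Coprime (a' ^ 3 + 2 * b' ^ 3) d →
    ∀ ϖ : ℝ, 0 < ϖ → ϖ < 1 / 5 →
      ∃ c C X₀ : ℝ, ∀ X η : ℝ, X₀ ≤ X → Real.exp (-Real.log X ^ (1 / 3 : ℝ)) ≤ η → η ≤ 1 →
        ∀ (k : ℕ) (m : Fin k → ℕ), CoreAdmissible (hbTau ϖ X) m →
          ∀ cR : Ideal (𝓞 K) → ℝ, CSupport X (hbTau ϖ X) cR →
            |bilin (classPairs X η d a b) pairIdeal cR (eWeight X (hbTau ϖ X) m) -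
                bilin (classPairs X η d a' b') pairIdeal cR (eWeight X (hbTau ϖ X) m)| ≤
              C * (∏ i, (m i : ℝ))⁻¹ * η ^ (5 / 2 : ℝ) * X ^ 2 * Real.log X ^ c

/-! ### (F) The sibling frame -/

/-- **(F1) Sibling band comparison** — output of the class-vs-class clones of `classTypeII_terms_band` /
`classSieveComparison_band` (with `(normWindow, classKappa)` replaced by `(classPairs … a' b', 1)`): fed by
`h35` for both classes (triangle inequality, same `classKappa`), the class Lemma 3.7
(`HeathBrownMoroz2004_lemma_3_3`, tree), `SiblingLeading`, and `h310` for both classes. -/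
def SiblingBand : Prop :=
  ∀ d a b a' b' : ℕ, 0 < d → a < d → b < d → a' < d → b' < d →
    Nat.Coprime (a ^ 3 + 2 * b ^ 3) d → Nat.Coprime (a' ^ 3 + 2 * b' ^ 3) d →
    ∃ c₀ : ℝ, 0 < c₀ ∧ ∀ c : ℝ, c₀ ≤ c → ∀ Kb : ℝ, 1 ≤ Kb → ∃ C X₀ : ℝ, ∀ X η : ℝ, X₀ ≤ X →
      Real.log X ^ (-c) ≤ η → η ≤ Kb * Real.log X ^ (-c) →
        |(classPrimeCount X η d a b : ℝ) - classPrimeCount X η d a' b'| ≤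
          C * (η ^ 2 * X ^ 2 / Real.log X * Real.log (Real.log X) ^ (-(1 / 6 : ℝ)))

/-- **(P) The parent band asymptotic** — `d = 1`: the existing chain `classAsymptotic_band 1 0 0` fed by the
tree's `HeathBrown2001_lemma_3_5_holds` / `_3_9_holds` / `_3_10_holds` (`classPairs_one`, `classWeight_one`). -/
def ParentBand : Prop :=
  ∃ c₀ : ℝ, 0 < c₀ ∧ ∃ σ₀ : ℝ, 0 < σ₀ ∧ Tendsto singularProductPartial atTop (𝓝 σ₀) ∧
    ∀ c : ℝ, c₀ ≤ c → ∀ Kb : ℝ, 1 ≤ Kb → ∃ C X₀ : ℝ, ∀ X η : ℝ, X₀ ≤ X →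
      Real.log X ^ (-c) ≤ η → η ≤ Kb * Real.log X ^ (-c) →
        |(primePairCount X η : ℝ) - σ₀ * η ^ 2 * X ^ 2 / (3 * Real.log X)| ≤
          C * (η ^ 2 * X ^ 2 / Real.log X * Real.log (Real.log X) ^ (-(1 / 6 : ℝ)))

/-- **(C) Class partition** (elementary, `Finset.card_eq_sum_card_fiberwise` on `(x mod d, y mod d)`; a
non-admissible class has no prime value `x³ + 2y³` once `X ≥ d`, since then `x³ + 2y³ > d ≥ p`). -/
def ClassPartition : Prop :=
  ∀ d : ℕ, 0 < d → ∃ X₀ : ℝ, ∀ X η : ℝ, X₀ ≤ X → 0 ≤ η →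
    ∑ ab ∈ (range d ×ˢ range d).filter (fun ab => Nat.Coprime (ab.1 ^ 3 + 2 * ab.2 ^ 3) d),
        classPrimeCount X η d ab.1 ab.2 = primePairCount X η

/-- **(F2) The averaging transfer**: sibling band + parent band + partition + `w(d)·ν*_d = d²`
(`classWeight_mul_card_coprimeClasses`, square-free `d`; prime powers lift class-by-class) give the class
band asymptotic — VERBATIM the hypothesis `hband` of the tree's `classAsymp_allLargeC_of_band`, whence the
crux by `heathBrownMorozUniform_of_allLargeC`. -/
def SiblingAverageTransfer : Prop :=
  SiblingBand → ParentBand → ClassPartition →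
    ∀ d a b : ℕ, 0 < d → a < d → b < d → Nat.Coprime (a ^ 3 + 2 * b ^ 3) d →
      ∃ c₀ : ℝ, 0 < c₀ ∧ ∃ σ₀ : ℝ, 0 < σ₀ ∧ Tendsto singularProductPartial atTop (𝓝 σ₀) ∧
        ∀ c : ℝ, c₀ ≤ c → ∀ Kb : ℝ, 1 ≤ Kb → ∃ C X₀ : ℝ, ∀ X η : ℝ, X₀ ≤ X →
          Real.log X ^ (-c) ≤ η → η ≤ Kb * Real.log X ^ (-c) →
          |(classPrimeCount X η d a b : ℝ) -
              classWeight d / (d : ℝ) ^ 2 * (σ₀ * η ^ 2 * X ^ 2 / (3 * Real.log X))| ≤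
            C * (η ^ 2 * X ^ 2 / Real.log X * Real.log (Real.log X) ^ (-(1 / 6 : ℝ)))

/-! ### The averaging inequality (the whole content of (F2), in the abstract) -/

/-- If `f i` is within `E` of every `f j`, `j ∈ s ∋ i`, then `f i` is within `E` of the average over `s`. -/
theorem abs_sub_avg_le {ι : Type*} (s : Finset ι) (f : ι → ℝ) (E : ℝ) {i : ι} (hi : i ∈ s)
    (h : ∀ j ∈ s, |f i - f j| ≤ E) :
    |f i - (∑ j ∈ s, f j) / s.card| ≤ E := by
  have hs : (0 : ℝ) < s.card := by exact_mod_cast Finset.card_pos.2 ⟨i, hi⟩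
  have key : f i - (∑ j ∈ s, f j) / s.card = (∑ j ∈ s, (f i - f j)) / s.card := by
    rw [Finset.sum_sub_distrib, Finset.sum_const, nsmul_eq_mul]
    field_simp
  rw [key, abs_div, abs_of_pos hs, div_le_iff₀ hs]
  calc |∑ j ∈ s, (f i - f j)| ≤ ∑ j ∈ s, |f i - f j| := Finset.abs_sum_le_sum_abs _ _
    _ ≤ ∑ j ∈ s, E := Finset.sum_le_sum h
    _ = E * s.card := by rw [Finset.sum_const, nsmul_eq_mul, mul_comm]

/-- The class version used by (F2): with `P = ∑_{j ∈ s} f j` the parent count and `M` its model,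
`|f i − M/#s| ≤ E + E'/#s` whenever the siblings are `E`-close and `|P − M| ≤ E'`. -/
theorem abs_sub_model_div_le {ι : Type*} (s : Finset ι) (f : ι → ℝ) (E E' M : ℝ) {i : ι} (hi : i ∈ s)
    (h : ∀ j ∈ s, |f i - f j| ≤ E) (hP : |∑ j ∈ s, f j - M| ≤ E') :
    |f i - M / s.card| ≤ E + E' / s.card := by
  have hs : (0 : ℝ) < s.card := by exact_mod_cast Finset.card_pos.2 ⟨i, hi⟩
  have h1 := abs_sub_avg_le s f E hi h
  have h2 : |(∑ j ∈ s, f j) / s.card - M / s.card| ≤ E' / s.card := by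
    rw [← sub_div, abs_div, abs_of_pos hs]
    exact div_le_div_of_nonneg_right hP hs.le
  calc |f i - M / s.card| = |(f i - (∑ j ∈ s, f j) / s.card) + ((∑ j ∈ s, f j) / s.card - M / s.card)| := by
        ring_nf
    _ ≤ |f i - (∑ j ∈ s, f j) / s.card| + |(∑ j ∈ s, f j) / s.card - M / s.card| := abs_add_le _ _
    _ ≤ E + E' / s.card := add_le_add h1 h2

end Summit.Parity.GeneralizedHardyLittlewood.Cruxes.HeathBrownMorozUniform.SiblingDifferencing

end
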